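import Literature.NumberTheory.EllipticCurves.TwoDescent
import Literature.NumberTheory.EllipticCurves.IsogenyTwoTorsionProofs
import HarnessLib

/-!
# The homomorphism `α : E(F) → F*/F*²` of the descent via `2`-isogeny and the solubility
# criterion for `N² = b₁M⁴ + aM²e² + b₂e⁴` (Silverman–Tate, *Rational Points on Elliptic Curves*, §3.5–3.6)

Topic `Literature/NumberTheory/EllipticCurves`; companion of `IsogenyTwoTorsionProofs.lean` (the
explicit `2`-isogeny of `E : y² = x³ + ax² + bx`, `WeierstrassCurve.IsTwoTorsionNF`, `T = (0,0)`),
`TwoIsogenyDescent.lean` (`ψ ∘ φ = [2]`, halving) and `TwoDescent.lean` (the square-class group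
`Affine.SqUnits F = Fˣ/(Fˣ)²`, `sqClass`). Everything here is PROVED; the only definitions are the
map `α` (`WeierstrassCurve.xSqClass`) and its bundling as a monoid homomorphism (`xSqClassHom`).

* `WeierstrassCurve.xSqClass W : E(F) → F*/F*²` — Silverman–Tate's `α`: `α(O) = 1`, `α(T) = b`,
  `α(x, y) = x (mod F*²)` (§3.5), for `W` in two-torsion normal form over a field `F`
  (`a = a₂`, `b = a₄`).
* `xSqClass_add` — **`α` is a homomorphism** (§3.5: by the chord identity `x₁x₂x₃ = ν²` for three
  collinear points — here Mathlib's `addPolynomial_slope` evaluated at `X = 0`,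
  `mul_mul_addX_eq_sq` — the translation formula `x(T + P) = b/x(P)` (`twoTorsionPoint_add_some`)
  and `α(-P) = α(P)`); hence its image is a subgroup (`xSqClassHom`, `mul_mem_range_xSqClass`).
* `exists_sq_eq_quartic_iff` — **the solubility criterion** of §3.6: for a factorisation
  `b = d d'` in `F`, the curve `w² = d u⁴ + a u²z² + d' z⁴` (Silverman–Tate's
  `N² = b₁M⁴ + aM²e² + b₂e⁴`, points with `(u, z) ≠ (0, 0)`) has an `F`-point iff `[d] ∈ α(E(F))`:
  `z = 0` gives `[d] = 1 = α(O)`, `u = 0` gives `[d] = [b] = α(T)`, and `uz ≠ 0` gives the point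
  `(d u²/z², d u w/z³)` ("`x = b₁M²/e²`, `y = b₁MN/e³`"); conversely `α(x, y) = [d]`, `x = d s²`,
  gives `(s, 1, y/(ds))`. Applied to `F = ℝ, ℚ_p` this identifies the local conditions of the
  explicit Selmer sets `Literature.NumberTheory.EllipticCurves.twoIsogenySelmerGroup`
  (`TwoIsogenySelmerGroup.lean`) with the subgroups `α(E(ℚ_v))`, which is how their group
  structure is proved (`TwoIsogenySelmerGroupStructure.lean`).

## References

* J. H. Silverman, J. T. Tate, *Rational Points on Elliptic Curves*, 2nd ed., UTM, Springer (2015),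
  §3.5 (the homomorphism `α`, "`x₁x₂x₃ = ν²`"), §3.6 (the equations `N² = b₁M⁴ + aM²e² + b₂e⁴`,
  "`x = b₁M²/e²`, `y = b₁MN/e³`"). [SilvermanTate2015]
* J. H. Silverman, *The Arithmetic of Elliptic Curves*, 2nd ed., GTM 106 (2009), Prop. X.4.9
  (`δ(ψ(P)) ≡ d`). [SilvermanAEC2009]

## Design

Deliberate dot-notation extensions in `namespace WeierstrassCurve` (`W.xSqClass`), as in the sibling
files; `open scoped Classical`, no `[DecidableEq]` variables; hypotheses `[W.IsTwoTorsionNF]`,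
`[W.IsElliptic]` (so `b ≠ 0`, `char F ≠ 2`) exactly where used.
-/

noncomputable section

open scoped Classical

namespace WeierstrassCurve

open WeierstrassCurve.Affine (sqClass sqClass_mul sqClass_mul_self sqClass_sq sqClass_eq_one_iff
  sqClass_eq_mul_of_mul_mul_eq_sq eval_addPolynomial)

variable {F : Type*} [Field F] (W : WeierstrassCurve F)

/-- **The homomorphism `α`** of the descent via `2`-isogeny (Silverman–Tate, *Rational Points on
Elliptic Curves*, §3.5: `α(O) = 1`, `α(T) = b`, `α(x, y) = x (mod F*²)`) on the `F`-points of
`E : y² = x³ + ax² + bx` (`W` in two-torsion normal form, `a = a₂`, `b = a₄`, `T = (0,0)`), with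
values in `F*/F*² = Affine.SqUnits F`. [cite: SilvermanTate2015, §3.5 (the map α)] -/
def xSqClass : W.toAffine.Point → Affine.SqUnits F
  | 0 => 1
  | .some x _ _ => if x = 0 then sqClass W.a₄ else sqClass x

/-- `α(O) = 1`. [cite: SilvermanTate2015, §3.5] -/
@[simp] theorem xSqClass_zero : W.xSqClass 0 = 1 := rfl

variable {W} in
/-- `α(T) = [b]` for the point with `x = 0`. [cite: SilvermanTate2015, §3.5] -/
theorem xSqClass_some_of_eq_zero {x y : F} (h : W.toAffine.Nonsingular x y) (hx : x = 0) :
    W.xSqClass (.some x y h) = sqClass W.a₄ := by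
  rw [xSqClass, if_pos hx]

variable {W} in
/-- `α(x, y) = [x]` for `x ≠ 0`. [cite: SilvermanTate2015, §3.5] -/
theorem xSqClass_some_of_ne_zero {x y : F} (h : W.toAffine.Nonsingular x y) (hx : x ≠ 0) :
    W.xSqClass (.some x y h) = sqClass x := by
  rw [xSqClass, if_neg hx]

/-- `α(-P) = α(P)` (`α` only depends on `x`). [folklore] -/
theorem xSqClass_neg (P : W.toAffine.Point) : W.xSqClass (-P) = W.xSqClass P := by
  rcases P with _ | ⟨x, y, h⟩
  · rfl
  · rw [Affine.Point.neg_some]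
    by_cases hx : x = 0
    · rw [xSqClass_some_of_eq_zero _ hx, xSqClass_some_of_eq_zero _ hx]
    · rw [xSqClass_some_of_ne_zero _ hx, xSqClass_some_of_ne_zero _ hx]

variable [W.IsTwoTorsionNF]

/-- **The chord identity behind `α`**: if `P₁ = (x₁, y₁)`, `P₂ = (x₂, y₂)` and `P₁ + P₂ = (x₃, *)`
on `y² = x³ + ax² + bx`, then `x₁x₂x₃ = (y₁ - ℓx₁)²` is the square of the `y`-intercept of the chord
(tangent) `y = ℓx + ν` — Mathlib's `addPolynomial_slope` (`W(X, ℓ(X - x₁) + y₁) = -(X - x₁)(X - x₂)(X - x₃)`)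
at `X = 0` (Silverman–Tate §3.5: "`x₁x₂x₃ = ν²`"). [cite: SilvermanTate2015, §3.5] -/
theorem mul_mul_addX_eq_sq {x₁ x₂ y₁ y₂ : F} (h₁ : W.toAffine.Nonsingular x₁ y₁)
    (h₂ : W.toAffine.Nonsingular x₂ y₂) (hxy : ¬(x₁ = x₂ ∧ y₁ = W.toAffine.negY x₂ y₂)) :
    x₁ * x₂ * W.toAffine.addX x₁ x₂ (W.toAffine.slope x₁ x₂ y₁ y₂) =
      (W.toAffine.slope x₁ x₂ y₁ y₂ * (0 - x₁) + y₁) ^ 2 := by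
  have hp := congrArg (Polynomial.eval 0) (Affine.addPolynomial_slope h₁.1 h₂.1 hxy)
  rw [eval_addPolynomial] at hp
  simp only [Polynomial.eval_neg, Polynomial.eval_mul, Polynomial.eval_sub, Polynomial.eval_X,
    Polynomial.eval_C, toAffine_a₁, toAffine_a₃, toAffine_a₂, toAffine_a₄, toAffine_a₆,
    a₁_of_isTwoTorsionNF, a₃_of_isTwoTorsionNF, a₆_of_isTwoTorsionNF] at hp
  linear_combination -hp

variable [W.IsElliptic]

/-- `α(T) = [b]`. [cite: SilvermanTate2015, §3.5] -/
@[simp] theorem xSqClass_twoTorsionPoint : W.xSqClass W.twoTorsionPoint = sqClass W.a₄ :=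
  xSqClass_some_of_eq_zero _ rfl

omit [W.IsTwoTorsionNF] [W.IsElliptic] in
variable {W} in
/-- `[b/x] = [b][x]` in `F*/F*²`. [folklore] -/
theorem sqClass_div_eq_mul {b x : F} (hb : b ≠ 0) (hx : x ≠ 0) :
    sqClass (b / x) = sqClass b * sqClass x :=
  sqClass_eq_mul_of_mul_mul_eq_sq hb hx (div_ne_zero hb hx) (z := b) (by field_simp)

variable {W} in
/-- `α(T + Q) = α(T) α(Q)` for `Q = (x₂, y₂)`, `x₂ ≠ 0`: `x(T + Q) = b/x₂`. [folklore] -/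
theorem xSqClass_twoTorsionPoint_add_some {x₂ y₂ : F} (h₂ : W.toAffine.Nonsingular x₂ y₂)
    (hx₂ : x₂ ≠ 0) :
    W.xSqClass (W.twoTorsionPoint + .some x₂ y₂ h₂) = sqClass W.a₄ * sqClass x₂ := by
  obtain ⟨h', e⟩ := twoTorsionPoint_add_some W h₂ hx₂
  rw [e, xSqClass_some_of_ne_zero _ (div_ne_zero (a₄_ne_zero W) hx₂)]
  exact sqClass_div_eq_mul (a₄_ne_zero W) hx₂

/-- **`α` is a homomorphism** `E(F) → F*/F*²` (Silverman–Tate §3.5, Proposition (b):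
"the map `α` … is a homomorphism"; proof by the chord identity `x₁x₂x₃ = ν²`, the translation
formula `x(P + T) = b/x(P)`, and `α(-P) = α(P)`). [cite: SilvermanTate2015, §3.5 (α is a homomorphism)] -/
theorem xSqClass_add (P Q : W.toAffine.Point) : W.xSqClass (P + Q) = W.xSqClass P * W.xSqClass Q := by
  have hb := a₄_ne_zero W
  rcases P with _ | ⟨x₁, y₁, h₁⟩
  · rw [← Affine.Point.zero_def, zero_add, xSqClass_zero, Affine.SqUnits.one_mul]
  rcases Q with _ | ⟨x₂, y₂, h₂⟩
  · rw [← Affine.Point.zero_def, add_zero, xSqClass_zero, Affine.SqUnits.mul_one]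
  by_cases hx₁ : x₁ = 0
  · -- `P = T`
    have hy₁ := y_eq_zero_of_x_eq_zero W h₁ hx₁
    subst hx₁ hy₁
    rw [show (Affine.Point.some 0 0 h₁ : W.toAffine.Point) = W.twoTorsionPoint from rfl,
      xSqClass_twoTorsionPoint]
    by_cases hx₂ : x₂ = 0
    · have hy₂ := y_eq_zero_of_x_eq_zero W h₂ hx₂
      subst hx₂ hy₂
      rw [show (Affine.Point.some 0 0 h₂ : W.toAffine.Point) = W.twoTorsionPoint from rfl,
        twoTorsionPoint_add_twoTorsionPoint, xSqClass_zero, xSqClass_twoTorsionPoint]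
      exact (Affine.SqUnits.mul_self _).symm
    · rw [xSqClass_twoTorsionPoint_add_some h₂ hx₂, xSqClass_some_of_ne_zero _ hx₂]
  by_cases hx₂ : x₂ = 0
  · -- `Q = T`
    have hy₂ := y_eq_zero_of_x_eq_zero W h₂ hx₂
    subst hx₂ hy₂
    rw [show (Affine.Point.some 0 0 h₂ : W.toAffine.Point) = W.twoTorsionPoint from rfl, add_comm,
      xSqClass_twoTorsionPoint_add_some h₁ hx₁, xSqClass_some_of_ne_zero _ hx₁, xSqClass_twoTorsionPoint]
    exact Affine.SqUnits.mul_comm _ _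
  -- generic: `x₁, x₂ ≠ 0`
  rw [xSqClass_some_of_ne_zero _ hx₁, xSqClass_some_of_ne_zero _ hx₂]
  by_cases hxy : x₁ = x₂ ∧ y₁ = W.toAffine.negY x₂ y₂
  · -- `Q = -P`
    rw [Affine.Point.add_of_Y_eq hxy.1 hxy.2, xSqClass_zero, hxy.1, ← sqClass_mul hx₂ hx₂,
      sqClass_mul_self]
  rw [Affine.Point.add_some hxy]
  by_cases hx₃ : W.toAffine.addX x₁ x₂ (W.toAffine.slope x₁ x₂ y₁ y₂) = 0
  · -- `P + Q = T`, so `Q = T - P` and `x₂ = b/x₁`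
    rw [xSqClass_some_of_eq_zero _ hx₃]
    have hPQ : (Affine.Point.some x₁ y₁ h₁ + Affine.Point.some x₂ y₂ h₂ : W.toAffine.Point) =
        W.twoTorsionPoint := by
      rw [Affine.Point.add_some hxy, twoTorsionPoint]
      simp only [Affine.Point.some.injEq]
      exact ⟨hx₃, y_eq_zero_of_x_eq_zero W (Affine.nonsingular_add h₁ h₂ hxy) hx₃⟩
    have hQ : (Affine.Point.some x₂ y₂ h₂ : W.toAffine.Point) =
        W.twoTorsionPoint + -Affine.Point.some x₁ y₁ h₁ := by
      rw [add_comm]; exact eq_neg_add_iff_add_eq.mpr hPQ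
    rw [Affine.Point.neg_some] at hQ
    obtain ⟨h', e⟩ := twoTorsionPoint_add_some W ((Affine.nonsingular_neg ..).mpr h₁) hx₁
    rw [e, Affine.Point.some.injEq] at hQ
    rw [hQ.1, sqClass_div_eq_mul hb hx₁, ← mul_assoc, ← sqClass_mul hx₁ hb, mul_comm x₁,
      sqClass_mul hb hx₁, mul_assoc, Affine.SqUnits.mul_self, Affine.SqUnits.mul_one]
  · rw [xSqClass_some_of_ne_zero _ hx₃]
    exact sqClass_eq_mul_of_mul_mul_eq_sq hx₁ hx₂ hx₃ (W.mul_mul_addX_eq_sq h₁ h₂ hxy)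

/-- `α` as a monoid homomorphism `E(F) → F*/F*²` (additive source written multiplicatively).
[cite: SilvermanTate2015, §3.5] -/
def xSqClassHom : Multiplicative W.toAffine.Point →* Affine.SqUnits F where
  toFun P := W.xSqClass P.toAdd
  map_one' := W.xSqClass_zero
  map_mul' P Q := W.xSqClass_add P.toAdd Q.toAdd

/-- The image `α(E(F))` is a subgroup of `F*/F*²`. [cite: SilvermanTate2015, §3.5] -/
theorem range_xSqClass_eq : Set.range W.xSqClass = (W.xSqClassHom).range := by
  ext g
  simp only [Set.mem_range, MonoidHom.coe_range, xSqClassHom, MonoidHom.coe_mk, OneHom.coe_mk]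
  constructor
  · rintro ⟨P, rfl⟩; exact ⟨Multiplicative.ofAdd P, rfl⟩
  · rintro ⟨P, rfl⟩; exact ⟨P.toAdd, rfl⟩

/-- The image of `α` is closed under multiplication. [folklore] -/
theorem mul_mem_range_xSqClass {g₁ g₂ : Affine.SqUnits F} (h₁ : g₁ ∈ Set.range W.xSqClass)
    (h₂ : g₂ ∈ Set.range W.xSqClass) : g₁ * g₂ ∈ Set.range W.xSqClass := by
  obtain ⟨P, rfl⟩ := h₁
  obtain ⟨Q, rfl⟩ := h₂
  exact ⟨P + Q, W.xSqClass_add P Q⟩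

/-! ### The solubility criterion: `N² = b₁M⁴ + aM²e² + b₂e⁴` has a point iff `[b₁] ∈ α(E(F))` -/

omit [W.IsElliptic] in
variable {W} in
/-- A solution `(u, z, w)`, `u, z ≠ 0`, of `w² = d u⁴ + a u²z² + d' z⁴` (`d d' = b`) gives the point
`(x, y) = (d u²/z², d u w/z³)` of `E : y² = x³ + ax² + bx` (Silverman–Tate §3.6:
"`x = b₁M²/e²`, `y = b₁MN/e³`"). [cite: SilvermanTate2015, §3.6] -/
theorem equation_of_sq_eq_quartic {d d' u z w : F} (hdd : d * d' = W.a₄) (hz : z ≠ 0)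
    (h : w ^ 2 = d * u ^ 4 + W.a₂ * u ^ 2 * z ^ 2 + d' * z ^ 4) :
    W.toAffine.Equation (d * u ^ 2 / z ^ 2) (d * u * w / z ^ 3) := by
  rw [equation_iff_of_isTwoTorsionNF, ← hdd]
  field_simp
  linear_combination d ^ 2 * u ^ 2 * h

variable {W} in
/-- **Solubility criterion** (Silverman–Tate §3.6; the local content of *AEC* X.4.9
"`δ(ψ(P)) ≡ d`"): for `d d' = b`, the curve `w² = d u⁴ + a u²z² + d' z⁴` has a point with
`(u, z) ≠ (0, 0)` over `F` iff `[d] ∈ α(E(F))`: a point with `z = 0` means `d ∈ F*²` (`= α(O)`),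
one with `u = 0` means `d' ∈ F*²`, i.e. `[d] = [b] = α(T)`, and one with `uz ≠ 0` gives
`P = (d u²/z², d u w/z³)` with `α(P) = [d]`; conversely `α(x, y) = [d]`, `x = d s²`, gives
`(u, z, w) = (s, 1, y/(ds))`. [cite: SilvermanTate2015, §3.6] -/
theorem exists_sq_eq_quartic_iff {d d' : F} (hdd : d * d' = W.a₄) :
    (∃ u z w : F, (u ≠ 0 ∨ z ≠ 0) ∧ w ^ 2 = d * u ^ 4 + W.a₂ * u ^ 2 * z ^ 2 + d' * z ^ 4) ↔
      sqClass d ∈ Set.range W.xSqClass := by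
  have hb := a₄_ne_zero W
  have hd : d ≠ 0 := fun h0 => hb (by rw [← hdd, h0, zero_mul])
  have hd' : d' ≠ 0 := fun h0 => hb (by rw [← hdd, h0, mul_zero])
  constructor
  · rintro ⟨u, z, w, h0, h⟩
    by_cases hz : z = 0
    · -- `d = (w/u²)²`: the class of `O`
      have hu : u ≠ 0 := h0.resolve_right (fun h' => h' hz)
      refine ⟨0, ?_⟩
      rw [xSqClass_zero, eq_comm, sqClass_eq_one_iff hd]
      exact ⟨w / u ^ 2, by field_simp; rw [h, hz]; ring⟩
    by_cases hu : u = 0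
    · -- `d' = (w/z²)²`: the class of `T`
      refine ⟨W.twoTorsionPoint, ?_⟩
      rw [xSqClass_twoTorsionPoint, ← hdd, sqClass_mul hd hd', (sqClass_eq_one_iff hd').mpr
        ⟨w / z ^ 2, by field_simp; rw [h, hu]; ring⟩, Affine.SqUnits.mul_one]
    · -- generic: the point `(d u²/z², d u w/z³)`
      have hE := equation_of_sq_eq_quartic hdd hz h
      have hx : d * u ^ 2 / z ^ 2 ≠ 0 := by positivity
      refine ⟨.some _ _ ((Affine.equation_iff_nonsingular).mp hE), ?_⟩
      rw [xSqClass_some_of_ne_zero _ hx, show d * u ^ 2 / z ^ 2 = d * (u / z) ^ 2 by ring,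
        sqClass_mul hd (by positivity), sqClass_sq, Affine.SqUnits.mul_one]
  · rintro ⟨P, hP⟩
    rcases P with _ | ⟨x, y, hxy⟩
    · -- `[d] = 1`
      rw [← Affine.Point.zero_def, xSqClass_zero, eq_comm, sqClass_eq_one_iff hd] at hP
      obtain ⟨t, rfl⟩ := hP
      exact ⟨1, 0, t, Or.inl one_ne_zero, by ring⟩
    by_cases hx : x = 0
    · -- `[d] = [b]`, so `d'` is a square
      rw [xSqClass_some_of_eq_zero _ hx, ← hdd, sqClass_mul hd hd'] at hP
      have h1 : sqClass d' = 1 := by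
        calc sqClass d' = sqClass d * sqClass d * sqClass d' := by
              rw [Affine.SqUnits.mul_self, Affine.SqUnits.one_mul]
          _ = sqClass d * sqClass d := by rw [mul_assoc, hP]
          _ = 1 := Affine.SqUnits.mul_self _
      obtain ⟨t, rfl⟩ := (sqClass_eq_one_iff hd').mp h1
      exact ⟨0, 1, t, Or.inr one_ne_zero, by ring⟩
    · -- `[d] = [x]`: `x d = t²`, `x = d (t/d)²`
      rw [xSqClass_some_of_ne_zero _ hx] at hP
      have h1 : sqClass (x * d) = 1 := by rw [sqClass_mul hx hd, hP, Affine.SqUnits.mul_self]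
      obtain ⟨t, ht⟩ := (sqClass_eq_one_iff (mul_ne_zero hx hd)).mp h1
      have e := rel_of_nonsingular W hxy
      have ht0 : t ≠ 0 := by
        rintro rfl
        exact mul_ne_zero hx hd (by rw [ht]; ring)
      refine ⟨t / d, 1, y / t, Or.inl (div_ne_zero ht0 hd), ?_⟩
      have hd'' : d' = W.a₄ / d := by rw [← hdd]; field_simp
      have hx' : x = t ^ 2 / d := by field_simp; linear_combination ht
      subst hx'
      rw [hd'']
      field_simp at e ⊢
      linear_combination e

end WeierstrassCurve
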